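import Summits.AtomisticToContinuum.BoseEinsteinCondensation.Theorems.BECTangentRigidityRigidMomentumBoundStubInsertionBound
import Literature.MathematicalPhysics.QuantumManyBody.BoseGasInsertionScaling
import HarnessLib

/-!
# Crux `GroundStateRigidity` (stmt-AtomisticToContinuum-9072), lines `permanent_member` /
# `lonely_insertion`: the registered stub `stub_insertionDisjoint` (Stub B)

Supports (does not close) stmt-AtomisticToContinuum-9072; registered stub `stub_insertionDisjoint`
(Stub B of the lines `permanent_member` / `lonely_insertion`, Stub B of skeleton v9 of line `Sketch`
before its reshape to `stub_insertionWindow`; lead c5). **Bosonic insertion bound at dilution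
`1000`.** There is an absolute `A > 0` (here `A = 10`) such that for `n ≥ 1` bosons in the
Dirichlet box `Λ_L`, a measurable pair profile `v ≥ 0` of range `R ≥ 0` (`v = 0` beyond `R`,
anything — `⊤` included — below) and a length `ℓ > R` with `1000 n ℓ³ ≤ L³`:
`E₀(n+1, L) ≤ E₀(n, L) + A/ℓ²`.

## Proof

The tree's chemical-potential bound `RigidMomentumBound.InsertionBound.insertionBound_range_two`
(range `2`, Dyson's Jastrow-dressed insertion, LSSY2005 Thm 2.2) is stated at dilution `2000`
(`8n ≤ L³/2000`), and so is the dilation covariance `InsertionScaling.insertionBound_of_fixedRange`;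
at dilution `1000` with `R` close to `ℓ` neither applies verbatim. But the dilution enters the
range-`2` argument only in the final bookkeeping (the Jastrow mass defect `w ≤ 1190·n/L³` must have
`2w < 1`, and `8n ≤ L³/1000` still gives `2w ≤ 0.2975`). So we re-run that proof VERBATIM at dilution
`1000` (`insertionBound_range_two_1000`: `E₀(n+1, L) ≤ E₀(n, L) + 130/L² + 8000·n·2/L³`, constants
from `numeric_bound_1000`), rescale it to the range `ℓ` by the dilation covariance with a general
dilution constant (`insertionBound_of_fixedRange_gen`, the proof of
`InsertionScaling.insertionBound_of_fixedRange` with `2000 ↦ D`), and finish with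
`130/L² + 8000 n ℓ/L³ ≤ 10/ℓ²` (`L ≥ 10 ℓ`).
-/

noncomputable section

open MeasureTheory Filter Set Metric
open scoped ENNReal NNReal Topology

namespace Summit.AtomisticToContinuum.BoseEinsteinCondensation.Theorems.GroundStateRigidity

open Literature.MathematicalPhysics.QuantumManyBody.BoseGas
open Summit.AtomisticToContinuum.BoseEinsteinCondensation.Cruxes.OneBodyEntropyBound.Birth

namespace InsertionDisjoint

/-! ### Scale covariance with a general dilution constant -/

/-- **Scale covariance of the insertion bound (general dilution `D > 0`).** A bound
`E₀(N+1, L) ≤ E₀(N, L) + A/L² + B·N·c/L³` for all measurable potentials of ONE fixed range `c > 0`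
at density `N c³ ≤ L³/D` implies the same bound with `c` replaced by the range `R₀` of an arbitrary
finite-range potential at density `N R₀³ ≤ L³/D` (dilate space by `s = c/R₀`;
`E₀(s⁻²v(·/s), N, sL) = s⁻² E₀(v, N, L)`, `JelliumBoseGas.groundStateEnergy_dilate`). The proof of
`InsertionScaling.insertionBound_of_fixedRange` with `2000 ↦ D`. [folklore] -/
theorem insertionBound_of_fixedRange_gen {c A B D : ℝ} (hc : 0 < c)
    (h : ∀ (v : ℝ → ℝ≥0∞), Measurable v → (∀ r, c < r → v r = 0) →
      ∀ (N : ℕ) (L : ℝ), 0 < L → (N : ℝ) * c ^ 3 ≤ L ^ 3 / D →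
        groundStateEnergy v (N + 1) L ≤
          groundStateEnergy v N L + ENNReal.ofReal (A / L ^ 2 + B * N * c / L ^ 3))
    {v : ℝ → ℝ≥0∞} (hv : Measurable v) {R₀ : ℝ} (hR₀ : 0 < R₀)
    (hvR : ∀ r, R₀ < r → v r = 0) (N : ℕ) {L : ℝ} (hL : 0 < L)
    (hNL : (N : ℝ) * R₀ ^ 3 ≤ L ^ 3 / D) :
    groundStateEnergy v (N + 1) L ≤
      groundStateEnergy v N L + ENNReal.ofReal (A / L ^ 2 + B * N * R₀ / L ^ 3) := by
  -- adapted from Literature/MathematicalPhysics/QuantumManyBody/BoseGasInsertionScaling.lean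
  set s : ℝ := c / R₀ with hs_def
  have hs : 0 < s := div_pos hc hR₀
  have hsR : s * R₀ = c := div_mul_cancel₀ c hR₀.ne'
  have hdens : (N : ℝ) * c ^ 3 ≤ (s * L) ^ 3 / D := by
    rw [← hsR]
    calc (N : ℝ) * (s * R₀) ^ 3 = s ^ 3 * ((N : ℝ) * R₀ ^ 3) := by ring
      _ ≤ s ^ 3 * (L ^ 3 / D) := by gcongr
      _ = (s * L) ^ 3 / D := by ring
  have h1 := h (scalePotential s v) (InsertionScaling.measurable_scalePotential hv s)
    (fun r hr => InsertionScaling.scalePotential_eq_zero_of_lt hs hvR (by rwa [hsR])) N (s * L)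
    (mul_pos hs hL) hdens
  rw [Literature.MathematicalPhysics.QuantumManyBody.JelliumBoseGas.groundStateEnergy_dilate _ _ _ hs,
    Literature.MathematicalPhysics.QuantumManyBody.JelliumBoseGas.groundStateEnergy_dilate _ _ _ hs]
    at h1
  have hX : A / (s * L) ^ 2 + B * N * c / (s * L) ^ 3 =
      (s ^ 2)⁻¹ * (A / L ^ 2 + B * N * R₀ / L ^ 3) := by
    rw [← hsR]; field_simp
  rw [hX, ENNReal.ofReal_mul (by positivity), ← mul_add] at h1
  exact (ENNReal.mul_le_mul_iff_right (ENNReal.ofReal_pos.2 (by positivity)).ne'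
    ENNReal.ofReal_ne_top).1 h1

/-! ### The bookkeeping at dilution `1000` -/

/-- **The numerical bookkeeping at dilution `1000`** (`π < 3.15`): with the kinetic constant
`c' = (2 · 48π²/11 + 1)/L²` and the Jastrow mass defect `w' = (16/11)³ · (n/L³) · 4π(92/3)` at
density `8n ≤ L³/1000`, `(c' + 9w')/(1 - 2w') ≤ 130/L² + 8000 · n · 2/L³`. [folklore] -/
theorem numeric_bound_1000 {L : ℝ} {n : ℕ} (hL : 0 < L) (hn : (n : ℝ) * 2 ^ 3 ≤ L ^ 3 / 1000) :
    (2 * (3 * Real.pi ^ 2 / (11 / 16) / L ^ 2) + 1 / L ^ 2 +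
        9 * ((11 / 16 : ℝ)⁻¹ ^ 3 / L ^ 3 * (n * (4 * Real.pi * (92 / 3))))) /
      (1 - 2 * ((11 / 16 : ℝ)⁻¹ ^ 3 / L ^ 3 * (n * (4 * Real.pi * (92 / 3))))) ≤
      130 / L ^ 2 + 8000 * n * 2 / L ^ 3 := by
  -- adapted from `RigidMomentumBound.InsertionBound.numeric_bound` (dilution `2000`)
  have hπ := Real.pi_lt_d2
  have hπ0 := Real.pi_pos
  set a : ℝ := 1 / L ^ 2 with ha
  set y : ℝ := (n : ℝ) / L ^ 3 with hy
  have ha0 : 0 < a := by positivity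
  have hy0 : 0 ≤ y := by positivity
  have hL3 : 0 < L ^ 3 := by positivity
  have hy1 : y ≤ 1 / 8000 := by
    rw [hy, div_le_iff₀ hL3]; linarith
  -- the constants
  have hK : (11 / 16 : ℝ)⁻¹ ^ 3 * (4 * Real.pi * (92 / 3)) ≤ 1190 := by nlinarith
  have hK0 : 0 ≤ (11 / 16 : ℝ)⁻¹ ^ 3 * (4 * Real.pi * (92 / 3)) := by positivity
  have hc : 2 * (3 * Real.pi ^ 2 / (11 / 16)) + 1 ≤ 88 := by nlinarith
  -- everything in terms of `a` and `y`
  have e1 : 2 * (3 * Real.pi ^ 2 / (11 / 16) / L ^ 2) + 1 / L ^ 2 =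
      (2 * (3 * Real.pi ^ 2 / (11 / 16)) + 1) * a := by rw [ha]; ring
  have e2 : (11 / 16 : ℝ)⁻¹ ^ 3 / L ^ 3 * (n * (4 * Real.pi * (92 / 3))) =
      ((11 / 16 : ℝ)⁻¹ ^ 3 * (4 * Real.pi * (92 / 3))) * y := by rw [hy]; ring
  have e3 : (130 : ℝ) / L ^ 2 + 8000 * n * 2 / L ^ 3 = 130 * a + 16000 * y := by
    rw [ha, hy]; ring
  rw [e1, e2, e3]
  set K : ℝ := (11 / 16 : ℝ)⁻¹ ^ 3 * (4 * Real.pi * (92 / 3)) with hKdef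
  set c₀ : ℝ := 2 * (3 * Real.pi ^ 2 / (11 / 16)) + 1 with hc₀
  have hKy : K * y ≤ 1190 / 8000 := by
    calc K * y ≤ 1190 * (1 / 8000) := mul_le_mul hK hy1 hy0 (by norm_num)
      _ = 1190 / 8000 := by norm_num
  have hden : (7 : ℝ) / 10 ≤ 1 - 2 * (K * y) := by linarith
  rw [div_le_iff₀ (by linarith)]
  have hc₀0 : 0 ≤ c₀ := by rw [hc₀]; positivity
  -- `c₀ a + 9 K y ≤ (130 a + 16000 y) (7/10) ≤ (130 a + 16000 y)(1 - 2 K y)`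
  have h1 : c₀ * a + 9 * (K * y) ≤ (130 * a + 16000 * y) * (7 / 10) := by nlinarith
  have h2 : (130 * a + 16000 * y) * (7 / 10) ≤ (130 * a + 16000 * y) * (1 - 2 * (K * y)) :=
    mul_le_mul_of_nonneg_left hden (by positivity)
  linarith

/-! ### The insertion bound at range `2`, dilution `1000` -/

open RigidMomentumBound.InsertionBound in
/-- **Insertion bound for potentials of range `2` at dilution `1000`.** For measurable `v` with
`v(r) = 0` for `r > 2`, `n` particles in the box `L` with `8n ≤ L³/1000`:
`E₀(n+1, L) ≤ E₀(n, L) + 130/L² + 8000 · n · 2/L³`. The proof of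
`RigidMomentumBound.InsertionBound.insertionBound_range_two` verbatim (flat-top orbital dressed
with the product Jastrow factor of the exponential profile, first variation at every frozen position
of the inserted particle, Dirichlet bosonic floor, cancelling the mass), with the bookkeeping
`numeric_bound_1000` (the Jastrow mass defect is still `≤ 0.15 < 1/2`). Dyson's device
(LSSY2005, Thm 2.2 / (2.17)–(2.26)). [cite: LSSY2005, Thm 2.2 (2.17)–(2.26)] -/
theorem insertionBound_range_two_1000 (v : ℝ → ℝ≥0∞) (hv : Measurable v)
    (hv2 : ∀ r, 2 < r → v r = 0) (n : ℕ) (L : ℝ) (hL : 0 < L)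
    (hnL : (n : ℝ) * 2 ^ 3 ≤ L ^ 3 / 1000) :
    groundStateEnergy v (n + 1) L ≤
      groundStateEnergy v n L + ENNReal.ofReal (130 / L ^ 2 + 8000 * n * 2 / L ^ 3) := by
  -- adapted from Summits/…/Theorems/BECTangentRigidityRigidMomentumBoundStubInsertionBound.lean
  -- nothing to prove if `E₀(n, L) = ∞`
  rcases eq_or_ne (groundStateEnergy v n L) ⊤ with htop | htop
  · rw [htop, top_add]; exact le_top
  -- the Jastrow profile and the product Jastrow factor
  obtain ⟨hfC, hf01, hfR, hfD⟩ := prof_props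
  set f : Space → ℝ := fun z : Space => 1 - (1 + max (‖z‖ - 2) 0) * Real.exp (-max (‖z‖ - 2) 0)
    with hfdef
  obtain ⟨hFC, hFX⟩ := stub_productJastrow f hfC hf01 hfD n
  set F : Config (n + 1) → ℝ := fun X => ∏ j : Fin n, f (X 0 - X j.succ) with hFdef
  have hF01 : ∀ X, 0 ≤ F X ∧ F X ≤ 1 := fun X => (hFX X).1
  have hF0 : ∀ (X : Config (n + 1)) (w : Space),
      ‖fderiv ℝ F X (Pi.single 0 w)‖ ≤ (1 - F X) * ‖w‖ := fun X w => (hFX X).2.1 w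
  have hFj : ∀ (X : Config (n + 1)) (j : Fin n) (w : Space),
      ‖fderiv ℝ F X (Pi.single j.succ w)‖ ≤ (1 - f (X 0 - X j.succ)) * ‖w‖ :=
    fun X j w => (hFX X).2.2.1 j w
  have hFsum : ∀ X : Config (n + 1), 1 - F X ≤ ∑ j : Fin n, (1 - f (X 0 - X j.succ)) :=
    fun X => (hFX X).2.2.2
  have hFd : Differentiable ℝ F := hFC.differentiable one_ne_zero
  have hG5 := fun (x : Space) (Z : Config n) (j : Fin n) (k : Fin 3) =>
    InsertionAssembly.sq_fderiv_sliceFactor_single_le hFd (fun z => (hf01 z).1) hFj x Z j k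
  have hcross : ∀ (x : Space) (Z : Config n) (j : Fin n),
      v (dist x (Z j)) = 0 ∨ F (Matrix.vecCons x Z) = 0 := fun x Z j =>
    cross_or_factor_eq_zero hv2 hfR x Z j
  -- the slack and the near-minimiser
  have hκ : (0 : ℝ) < 1 / L ^ 2 := by positivity
  obtain ⟨d, hd, hsqrt⟩ := InsertionAssembly.exists_delta_small
    (E := (groundStateEnergy v n L).toReal) ENNReal.toReal_nonneg n hκ
  have hlt : groundStateEnergy v n L < groundStateEnergy v n L + ENNReal.ofReal d :=
    ENNReal.lt_add_right htop (ENNReal.ofReal_pos.2 hd).ne'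
  obtain ⟨Φ, hΦ⟩ := iInf_lt_iff.mp hlt
  -- the first variation at every frozen position of the inserted particle (`D = n`)
  have hJ3x : ∀ x : Space,
      ∫⁻ Z, (kineticDensity (fun Z : Config n => (F (Matrix.vecCons x Z) : ℂ) * Φ.ψ Z) Z +
        interaction v Z * (‖(F (Matrix.vecCons x Z) : ℂ) * Φ.ψ Z‖₊ : ℝ≥0∞) ^ 2) ≤
      groundStateEnergy v n L *
          (∫⁻ Z, ENNReal.ofReal (F (Matrix.vecCons x Z) ^ 2) * (‖Φ.ψ Z‖₊ : ℝ≥0∞) ^ 2) +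
        (∫⁻ Z, (∑ j : Fin n, ∑ k : Fin 3, ENNReal.ofReal
          ((fderiv ℝ (fun Z : Config n => F (Matrix.vecCons x Z)) Z
            (Pi.single j (EuclideanSpace.single k (1 : ℝ)))) ^ 2)) * (‖Φ.ψ Z‖₊ : ℝ≥0∞) ^ 2) +
        ENNReal.ofReal (1 / L ^ 2) := by
    intro x
    have h := stub_firstVariation n L v hv Φ (ENNReal.ofReal d) ENNReal.ofReal_ne_top htop hΦ.le
      (fun Z : Config n => F (Matrix.vecCons x Z))
      (hFC.comp (InsertionAssembly.contDiff_vecCons_right x))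
      (fun Z => hF01 _) (InsertionAssembly.sliceFactor_symm f x) n
      (InsertionAssembly.norm_fderiv_sliceFactor_le hFd (fun z => (hf01 z).1) hFj x)
    rw [ENNReal.toReal_ofReal hd.le] at h
    exact h.trans (add_le_add le_rfl (ENNReal.ofReal_le_ofReal hsqrt))
  -- the flat-top orbital
  obtain ⟨b, b', hbd, hb'c, hb01, hbsupp, hbm, hbκ, hbi, hbi'⟩ := FlatTop.exists_flatTopProfile
  obtain ⟨Θ, hΘE, hΘsup⟩ := ProductOrbital.exists_productOrbital hbd hb'c hb01 hbsupp
    (by norm_num : (0 : ℝ) < 11 / 16) hbm hbκ hbi hbi' hL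
  -- one dressed insertion
  obtain ⟨hins, hlow, hM1⟩ := InsertionAssembly.dressed_insertion_at hv
    (fun g hg h0 => DirichletFloor.groundStateEnergy_mul_lintegral_le hv hg h0) hfC hf01 hFC hF01
    hF0 hFsum Φ Θ (z := 0) (fun x hx => by simpa using hx) hcross hG5 hJ3x
  -- the Jastrow weight: `w ≤ sup|Θ|² · n · ∫(1 - f)`
  have hw : (∫⁻ x, (‖Θ.ψ (fun _ => x - 0)‖₊ : ℝ≥0∞) ^ 2 *
      ∫⁻ Z : Config n, (∑ j : Fin n, ENNReal.ofReal (1 - f (x - Z j))) *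
        (‖Φ.ψ Z‖₊ : ℝ≥0∞) ^ 2) ≤
      ENNReal.ofReal ((11 / 16 : ℝ)⁻¹ ^ 3 / L ^ 3 * (n * (4 * Real.pi * (92 / 3)))) := by
    have hmW := InsertionAssembly.measurable_W₁ (n := n) hfC.continuous Φ.contDiff.continuous
    calc _ ≤ ∫⁻ x, ENNReal.ofReal ((11 / 16 : ℝ)⁻¹ ^ 3 / L ^ 3) *
          ∫⁻ Z : Config n, (∑ j : Fin n, ENNReal.ofReal (1 - f (x - Z j))) *
            (‖Φ.ψ Z‖₊ : ℝ≥0∞) ^ 2 :=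
          lintegral_mono fun x => mul_le_mul' (hΘsup _) le_rfl
      _ = ENNReal.ofReal ((11 / 16 : ℝ)⁻¹ ^ 3 / L ^ 3) *
          (n * ∫⁻ y : Space, ENNReal.ofReal (1 - f y)) := by
          rw [lintegral_const_mul _ hmW,
            InsertionAssembly.lintegral_W₁ hfC.continuous Φ.contDiff.continuous Φ.norm_eq]
      _ ≤ ENNReal.ofReal ((11 / 16 : ℝ)⁻¹ ^ 3 / L ^ 3) *
          (n * ENNReal.ofReal (4 * Real.pi * (92 / 3))) := by
          gcongr; exact lintegral_one_sub_prof_le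
      _ = _ := by
          rw [← ENNReal.ofReal_natCast n, ← ENNReal.ofReal_mul (Nat.cast_nonneg n),
            ← ENNReal.ofReal_mul (by positivity)]
  -- the kinetic constant: `2𝓔₀[Θ] + err ≤ (2 · 48π²/11 + 1)/L²`
  have hc : 2 * energy 0 Θ + ENNReal.ofReal (1 / L ^ 2) ≤
      ENNReal.ofReal (2 * (3 * Real.pi ^ 2 / (11 / 16) / L ^ 2) + 1 / L ^ 2) := by
    rw [ENNReal.ofReal_add (by positivity) (by positivity), ENNReal.ofReal_mul (by norm_num),
      ENNReal.ofReal_ofNat]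
    gcongr
  -- cancel the mass
  have hw' : (0 : ℝ) ≤ (11 / 16 : ℝ)⁻¹ ^ 3 / L ^ 3 * (n * (4 * Real.pi * (92 / 3))) := by
    positivity
  have h2w : 2 * ((11 / 16 : ℝ)⁻¹ ^ 3 / L ^ 3 * (n * (4 * Real.pi * (92 / 3)))) < 1 := by
    have hπ := Real.pi_lt_d2
    have hL3 : 0 < L ^ 3 := by positivity
    have hy : (n : ℝ) / L ^ 3 ≤ 1 / 8000 := by rw [div_le_iff₀ hL3]; linarith
    have : (11 / 16 : ℝ)⁻¹ ^ 3 / L ^ 3 * (n * (4 * Real.pi * (92 / 3))) =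
        ((11 / 16 : ℝ)⁻¹ ^ 3 * (4 * Real.pi * (92 / 3))) * (n / L ^ 3) := by ring
    rw [this]
    have hK : (11 / 16 : ℝ)⁻¹ ^ 3 * (4 * Real.pi * (92 / 3)) ≤ 1190 := by nlinarith
    have hKy : (11 / 16 : ℝ)⁻¹ ^ 3 * (4 * Real.pi * (92 / 3)) * (n / L ^ 3) ≤
        1190 * (1 / 8000) := mul_le_mul hK hy (by positivity) (by norm_num)
    linarith
  refine (InsertionScaling.final_bound_real hins hlow hM1 hc hw (by positivity) hw' h2w).trans ?_
  gcongr
  exact numeric_bound_1000 hL hnL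


/-- The numerical step: for `n ≥ 1`, `0 < ℓ`, `0 < L` and `1000 n ℓ³ ≤ L³`,
`130/L² + 8000·n·ℓ/L³ ≤ 10/ℓ²` (`L ≥ 10 ℓ`). [folklore] -/
theorem numeric_final {n : ℕ} {ℓ L : ℝ} (hn : 1 ≤ n) (hℓ : 0 < ℓ) (hL : 0 < L)
    (hnL : 1000 * (n : ℝ) * ℓ ^ 3 ≤ L ^ 3) :
    130 / L ^ 2 + 8000 * n * ℓ / L ^ 3 ≤ 10 / ℓ ^ 2 := by
  have hn1 : (1 : ℝ) ≤ n := by exact_mod_cast hn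
  have hℓ2 : 0 < ℓ ^ 2 := by positivity
  have hℓ3 : 0 < ℓ ^ 3 := by positivity
  have hL3 : 0 < L ^ 3 := by positivity
  -- `L ≥ 10 ℓ`
  have hcube : (10 * ℓ) ^ 3 ≤ L ^ 3 := by nlinarith
  have h10 : 10 * ℓ ≤ L := le_of_pow_le_pow_left₀ (by norm_num) hL.le hcube
  have hsq : 100 * ℓ ^ 2 ≤ L ^ 2 := by nlinarith
  have hA : 130 / L ^ 2 ≤ 2 / ℓ ^ 2 := by
    rw [div_le_div_iff₀ (by positivity) hℓ2]
    nlinarith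
  have hB : 8000 * n * ℓ / L ^ 3 ≤ 8 / ℓ ^ 2 := by
    rw [div_le_div_iff₀ hL3 hℓ2]
    have h0 : (0 : ℝ) ≤ n * ℓ ^ 3 := by positivity
    nlinarith
  calc 130 / L ^ 2 + 8000 * n * ℓ / L ^ 3 ≤ 2 / ℓ ^ 2 + 8 / ℓ ^ 2 := add_le_add hA hB
    _ = 10 / ℓ ^ 2 := by ring

end InsertionDisjoint

open InsertionDisjoint in
/-- **Stub B `stub_insertionDisjoint` of the lines `permanent_member` / `lonely_insertion` of the
crux `GroundStateRigidity` — bosonic insertion bound at dilution `1000`.** There is an absolute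
`A > 0` such that for `n ≥ 1` bosons in the Dirichlet box `Λ_L`, a measurable repulsive pair profile
`v` of range `R` (`v = 0` beyond `R`; `⊤` allowed below), and a length `ℓ > R` with
`1000 n ℓ³ ≤ L³`: `E₀(n+1, L) ≤ E₀(n, L) + A/ℓ²`. Proof: the range-`2` Jastrow-dressed insertion
bound re-run at dilution `1000` (`insertionBound_range_two_1000`), rescaled to the range `ℓ`
(`insertionBound_of_fixedRange_gen`), and `130/L² + 8000·n·ℓ/L³ ≤ 10/ℓ²`. (Not the
disjoint-support IMS construction of the line card, which remains an independent route.)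
[cite: LSSY2005, Thm 2.2 (2.17)–(2.26)] -/
theorem stub_insertionDisjoint :
    ∃ A : ℝ, 0 < A ∧ ∀ (n : ℕ) (L R ℓ : ℝ) (v : ℝ → ℝ≥0∞), 1 ≤ n → 0 < L → Measurable v →
      0 ≤ R → R < ℓ → (∀ r : ℝ, R < r → v r = 0) → 1000 * (n : ℝ) * ℓ ^ 3 ≤ L ^ 3 →
      groundStateEnergy v (n + 1) L ≤ groundStateEnergy v n L + ENNReal.ofReal (A / ℓ ^ 2) := by
  refine ⟨10, by norm_num, fun n L R ℓ v hn hL hv hR hRℓ hvR hnL => ?_⟩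
  have hℓ : 0 < ℓ := hR.trans_lt hRℓ
  have hvℓ : ∀ r, ℓ < r → v r = 0 := fun r hr => hvR r (hRℓ.trans hr)
  have hnL' : (n : ℝ) * ℓ ^ 3 ≤ L ^ 3 / 1000 := by
    rw [le_div_iff₀ (by norm_num : (0 : ℝ) < 1000)]
    linarith
  have h := insertionBound_of_fixedRange_gen (c := 2) (A := 130) (B := 8000) (D := 1000) two_pos
    (fun v hv hv2 N L hL hNL => insertionBound_range_two_1000 v hv hv2 N L hL hNL)
    hv hℓ hvℓ n hL hnL'
  exact h.trans (add_le_add_right (ENNReal.ofReal_le_ofReal (numeric_final hn hℓ hL hnL)) _)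

end Summit.AtomisticToContinuum.BoseEinsteinCondensation.Theorems.GroundStateRigidity

end
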